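import Literature.AlgebraicGeometry.Resolution.LinearProjection
import Literature.AlgebraicGeometry.Resolution.LinearSectionsCharts
import Literature.AlgebraicGeometry.Motives.VarietiesProjectiveSpaceProofs
import Mathlib.FieldTheory.IntermediateField.Adjoin.Basic
import Mathlib.AlgebraicGeometry.FunctionField

/-!
# `WeightedInvariant.WeightedThesis`, line `datum-glued-split`, stub 5a-F2:
# the rational functions of linear forms are `k`-linear and their ratios generate `K(X)`

Crux `WeightedThesis` (stmt-ResolutionOfSingularities-0569), registered stub
`stub_formFnLinearGenerates`. For an integral closed subscheme `ι : X ↪ ℙⁿ_k` (any field `k`) and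
`K(X)` given the `k`-algebra structure `k → Γ(Spec k) → Γ(X, ⊤) → K(X)`:

* `formFn_smul` — `c ↦ LinSec.formFn ι c = (Σ c_l x_l)/x_{j₀} ∈ K(X)` is `k`-linear (`dehomFn` is
  a ring homomorphism sending the constant polynomial `c` to the constant function `c`,
  `dehomFn_C`; additivity is the tree's `LinSec.formFn_add`);
* `adjoin_formFn_div_eq_top` — for every linear form `a₀` with `a₀ ≢ 0` on `X`, the ratios
  `formFn c / formFn a₀` generate `K(X)` over `k`: `K(X) = Frac Γ(X, D₊(x_h))` (Mathlib
  `functionField_isFractionRing_of_isAffineOpen`) for the chart `h = j₀` through the generic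
  point, `Γ(X, D₊(x_h)) = k[x_l/x_h]` (`LinSec.adjoin_coordSec_eq_top`), and
  `x_l/x_h = (formFn e_l / formFn a₀) / (formFn e_h / formFn a₀)` (`LinSec.ofSection_linSec`);
* `stub_formFnLinearGenerates` — the registered shape (universe `0`).

Everything is proved; no new definitions. [folklore; Hartshorne, *Algebraic Geometry*, I Prop. 4.9
(proof)]
-/

noncomputable section

set_option linter.dupNamespace false -- mandated namespace of this single-conjunct summit

open CategoryTheory AlgebraicGeometry TopologicalSpace Opposite HomogeneousLocalization
open Literature.AlgebraicGeometry.Morphisms.ProjCech (grading PP toSpec)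
open Literature.AlgebraicGeometry.Motives
open Literature.AlgebraicGeometry.Motives.ProjFrac
open Literature.AlgebraicGeometry.Motives.RatFn
open Literature.AlgebraicGeometry.Resolution

namespace Summit.ResolutionOfSingularities.ResolutionOfSingularities.Theorems.WeightedThesis.HypersurfaceModel

namespace FormFnGenerates

universe u

variable {k : Type u} [Field k] {n : ℕ} {X : Scheme.{u}} [IsIntegral X] (ι : X ⟶ PP k n)
  [Algebra k X.functionField]
  (halg : algebraMap k X.functionField = (X.presheaf.germ ⊤ (genericPoint X) trivial).hom.comp
    ((ι ≫ toSpec k n).appTop.hom.comp (Scheme.ΓSpecIso (.of k)).inv.hom))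

include halg

/-! ## Constants: the `k`-algebra structure `k → Γ(Spec k) → Γ(X, ⊤) → K(X)` -/

/-- **`dehomFn` on constants**: `(C c)(x/x_{j₀}) = c` in `K(X)` — `dehomAway (C c) = c/1`
(`ProjFrac.dehomAway_C`), `evalAway (c/1)` is the global function `c` restricted to the chart
(`ProjFrac.evalAway_algebraMap`), and germs do not see the restriction. [folklore] -/
theorem dehomFn_C (j₀ : Fin (n + 1)) (hj₀ : genericPoint X ∈ ZH ι (MvPolynomial.X j₀)) (c : k) :
    dehomFn ι j₀ hj₀ (MvPolynomial.C c) = algebraMap k X.functionField c := by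
  rw [dehomFn, RingHom.comp_apply, dehomAway_C, halg, fracFn_apply,
    evalAway_algebraMap ι (LinSec.X_mem j₀) one_pos]
  exact TopCat.Presheaf.germ_res_apply X.presheaf _ _ _ _

/-- **`formFn` is homogeneous in the coefficient vector**: `formFn (c • a) = c • formFn a`.
[folklore] -/
theorem formFn_smul (c : k) (a : Fin (n + 1) → k) :
    LinSec.formFn ι (c • a) = c • LinSec.formFn ι a := by
  rw [Algebra.smul_def (A := X.functionField)]
  simp only [LinSec.formFn, LinSec.linForm_smul, map_mul, dehomFn_C ι halg]

/-- The germ at the generic point of the constant `c ∈ Γ(chart h, 𝒪_X)` (for the chart algebra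
structure `LinSec.chartAlgebra`: constants are `evalAway (c/1)`) is the constant `c ∈ K(X)`.
[folklore] -/
theorem ofSection_algebraMap_chart (h : Fin (n + 1)) (hne : genericPoint X ∈ LinSec.chart ι h)
    (c : k) :
    letI := LinSec.chartAlgebra ι h
    ofSection hne (algebraMap k Γ(X, LinSec.chart ι h) c) = algebraMap k X.functionField c := by
  letI := LinSec.chartAlgebra ι h
  rw [LinSec.algebraMap_chart_apply, halg, evalAway_algebraMap ι (LinSec.X_mem h) one_pos]
  exact TopCat.Presheaf.germ_res_apply X.presheaf _ _ _ _

/-! ## Generation of `K(X)` by the ratios of linear forms -/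

/-- **The germ map `Γ(chart h, 𝒪_X) → K(X)` lands in any intermediate field containing the
rational functions of the affine coordinates `x_l/x_h`**: `Γ(chart h, 𝒪_X) = k[x_l/x_h]`
(`LinSec.adjoin_coordSec_eq_top`, `ι` a closed immersion) and the germ map is a `k`-algebra
homomorphism (`ofSection_algebraMap_chart`). [folklore] -/
theorem ofSection_mem_of_coordSec_mem [IsClosedImmersion ι]
    (F : IntermediateField k X.functionField) (h : Fin (n + 1))
    (hne : genericPoint X ∈ LinSec.chart ι h)
    (hcoord : ∀ l, ofSection hne (LinSec.coordSec ι h l) ∈ F) (s : Γ(X, LinSec.chart ι h)) :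
    ofSection hne s ∈ F := by
  letI := LinSec.chartAlgebra ι h
  -- the germ map as a `k`-algebra homomorphism
  let ψ : Γ(X, LinSec.chart ι h) →ₐ[k] X.functionField :=
    { (X.presheaf.germ (LinSec.chart ι h) (genericPoint X) hne).hom with
      commutes' := fun c => ofSection_algebraMap_chart ι halg h hne c }
  have hψ : ∀ t, ψ t = ofSection hne t := fun t => rfl
  have hs : s ∈ Algebra.adjoin k (Set.range (LinSec.coordSec ι h)) := by
    rw [LinSec.adjoin_coordSec_eq_top]; trivial
  have hmem : ψ s ∈ (Algebra.adjoin k (Set.range (LinSec.coordSec ι h))).map ψ := ⟨s, hs, rfl⟩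
  rw [AlgHom.map_adjoin] at hmem
  have hle : Algebra.adjoin k (ψ '' Set.range (LinSec.coordSec ι h)) ≤ F.toSubalgebra := by
    refine Algebra.adjoin_le ?_
    rintro _ ⟨_, ⟨l, rfl⟩, rfl⟩
    rw [hψ]
    exact hcoord l
  rw [← hψ]
  exact hle hmem

/-- **The ratios `formFn c / formFn a₀` generate `K(X)` over `k`** for every linear form `a₀`
with `formFn a₀ ≠ 0`: with `h = j₀` the chart through the generic point, the generated field
`F` contains `formFn e_l / formFn e_h = (formFn e_l / formFn a₀) / (formFn e_h / formFn a₀)`,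
the rational function of `x_l/x_h` (`LinSec.ofSection_linSec`, `LinSec.linSec_single`), hence the
image of `Γ(chart h, 𝒪_X)` (`ofSection_mem_of_coordSec_mem`), whose fraction field is `K(X)`
(Mathlib `functionField_isFractionRing_of_isAffineOpen`, `IsFractionRing.div_surjective`).
[folklore] -/
theorem adjoin_formFn_div_eq_top [IsClosedImmersion ι] (a₀ : Fin (n + 1) → k)
    (ha₀ : LinSec.formFn ι a₀ ≠ 0) :
    IntermediateField.adjoin k
      (Set.range fun c : Fin (n + 1) → k => LinSec.formFn ι c / LinSec.formFn ι a₀) = ⊤ := by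
  set F := IntermediateField.adjoin k
    (Set.range fun c : Fin (n + 1) → k => LinSec.formFn ι c / LinSec.formFn ι a₀) with hF
  have hne : genericPoint X ∈ LinSec.chart ι (LinSec.j₀ ι) := LinSec.genericPoint_mem_chart_j₀ ι
  have hmem : ∀ c, LinSec.formFn ι c / LinSec.formFn ι a₀ ∈ F := fun c =>
    IntermediateField.subset_adjoin _ _ ⟨c, rfl⟩
  have hratio : ∀ c, LinSec.formFn ι c / LinSec.formFn ι (Pi.single (LinSec.j₀ ι) 1) ∈ F :=
    fun c => by
    rw [← div_div_div_cancel_right₀ ha₀ (LinSec.formFn ι c)]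
    exact div_mem (hmem c) (hmem _)
  have hcoord : ∀ l, ofSection hne (LinSec.coordSec ι (LinSec.j₀ ι) l) ∈ F := fun l => by
    rw [← LinSec.linSec_single, LinSec.ofSection_linSec ι hne]
    exact hratio _
  -- `K(X) = Frac Γ(chart h, 𝒪_X)`
  haveI : Nonempty (LinSec.chart ι (LinSec.j₀ ι)) := ⟨⟨_, hne⟩⟩
  haveI := functionField_isFractionRing_of_isAffineOpen X (LinSec.chart ι (LinSec.j₀ ι))
    (LinSec.isAffineOpen_chart ι (LinSec.j₀ ι))
  refine eq_top_iff.mpr fun z _ => ?_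
  obtain ⟨a, b, -, rfl⟩ :=
    IsFractionRing.div_surjective (A := Γ(X, LinSec.chart ι (LinSec.j₀ ι))) z
  exact div_mem (ofSection_mem_of_coordSec_mem ι halg F _ hne hcoord a)
    (ofSection_mem_of_coordSec_mem ι halg F _ hne hcoord b)

/-- Both halves together, in the shape of the registered stub (arbitrary universe): the linear
map is `LinSec.formFn ι` with `LinSec.formFn_add` and `formFn_smul`. [folklore] -/
theorem exists_linearMap [IsClosedImmersion ι] :
    ∃ V : (Fin (n + 1) → k) →ₗ[k] X.functionField, (∀ c, V c = LinSec.formFn ι c) ∧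
      ∀ a₀ : Fin (n + 1) → k, LinSec.formFn ι a₀ ≠ 0 →
        IntermediateField.adjoin k
          (Set.range fun c : Fin (n + 1) → k => V c / LinSec.formFn ι a₀) = ⊤ :=
  ⟨{ toFun := LinSec.formFn ι
     map_add' := LinSec.formFn_add ι
     map_smul' := fun c a => formFn_smul ι halg c a },
    fun _ => rfl, fun a₀ ha₀ => adjoin_formFn_div_eq_top ι halg a₀ ha₀⟩

end FormFnGenerates

/-! ## The registered shape -/

/-- **STUB 5a-F2 (PROVED): the rational functions of the linear forms are `k`-linear in the
coefficients and their ratios generate the function field.** For an integral closed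
`X ⊆ ℙⁿ_k` (any field `k`), `c ↦ formFn ι c = (Σ c_l x_l)/x_{j₀} ∈ K(X)` is a `k`-linear map `V`,
and for every linear form `a₀` with `a₀ ≢ 0` on `X` the ratios `V c / formFn ι a₀` generate
`K(X)` over `k` (`FormFnGenerates.exists_linearMap`). [folklore] -/
theorem stub_formFnLinearGenerates : ∀ (k : Type) [Field k] (n : ℕ) (X : AlgebraicGeometry.Scheme.{0}) [AlgebraicGeometry.IsIntegral X] (ι : X ⟶ (Literature.AlgebraicGeometry.Motives.projectiveSpace n k).left) [AlgebraicGeometry.IsClosedImmersion ι] [Algebra k X.functionField], algebraMap k X.functionField = (X.presheaf.germ ⊤ (genericPoint X) trivial).hom.comp ((ι ≫ (Literature.AlgebraicGeometry.Motives.projectiveSpace n k).hom).appTop.hom.comp (AlgebraicGeometry.Scheme.ΓSpecIso (.of k)).inv.hom) → ∃ V : (Fin (n + 1) → k) →ₗ[k] X.functionField, (∀ c, V c = Literature.AlgebraicGeometry.Resolution.LinSec.formFn ι c) ∧ ∀ a₀ : Fin (n + 1) → k, Literature.AlgebraicGeometry.Resolution.LinSec.formFn ι a₀ ≠ 0 →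 IntermediateField.adjoin k (Set.range fun c : Fin (n + 1) → k => V c / Literature.AlgebraicGeometry.Resolution.LinSec.formFn ι a₀) = ⊤ := by
  intro k _ n X hX ι hι _ halg
  exact @FormFnGenerates.exists_linearMap k _ n X hX ι _ halg hι

end Summit.ResolutionOfSingularities.ResolutionOfSingularities.Theorems.WeightedThesis.HypersurfaceModel

end
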